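import Summits.BirchSwinnertonDyer.BirchSwinnertonDyer.Theorems.SignedLowerHalvesJSWssRankOneSprungRecordShape
import HarnessLib

/-!
# Route `SignedLowerHalves`, crux `KobayashiLowerHalfSemistable` (item stmt-BirchSwinnertonDyer-19000), token `JSW-ss@3` on
# RESIDUE classes, PER PAIR — SPRUNG-ROAD PRE-POSITIONING RECORDS at `p = 3`: `BSD(E,3)` for semistable analytic-rank-ONE curves
# with good SUPERSINGULAR reduction at `3` (`a₃ = 0`) and `#Ш_an` a `3`-unit, whose class is NOT in the literal row D2 because another
# cell is still OPEN (cell `bsd-litref`, paper sub-dir `jsw17`, seat `bsd-litref-jsw17-pv` gen 3; a `--supports stmt-BirchSwinnertonDyer-19000`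
# helper file; closes nothing about the crux)

PARTITION (programme BSD-LIT2PART v1 §T2e): pub-bsdpct/REFEREE.md R368.4 — after the D2 fold «`JSW-ss` entries remaining: 220 (187 @p ≥ 5
+ 33 @3) on 181 residue classes»; R369.1 — «a Sprung-road record for any of these pairs (… the jsw17-pv records on residue classes)
supersedes the cell same-cell as in R368, flag-free». Census read of this seat (kit j273580 on A's pickle a30decaf085a0313, 2026-08-27):
7 residue classes still carry `JSW-ss@3` (the other 26 @3 entries of R368.4 were closed since by other roads). Each record closes ITS pair —
of record closed ONLY by `Partition.RowC3.bsdp` through `JetchevSkinnerWan2017.thm121_padicValRat_bsd_rank_one` [PUB\*] — INSTEAD through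
the booked shape `Theorems.X6.X6RankOne.bsdp_three_of_cor13_of_ainvs_of_countPointsFast_of_shaAn_unit` (p459430) over cell `b2b-bsdres`'s
`Supersingular.X6.bsdp_of_analyticRank_eq_one_of_shaAn_le`: UPPER half = Sprung 2024 Cor. 1.3 second sentence (REFEREED, A96, C2 R332;
word (α) flag-free on the 880-class D2@3 population, A R368/R412), LOWER half = `ord₃ #Ш_an ≤ 0 ≤ ord₃ #Ш`. 0 CLASSES MOVE TODAY BY DESIGN
(open cell elsewhere); the record pre-positions the class. Kernel per record: `Δ ≠ 0`, minimality (bounded Kraus), `3 ∤ Δ`,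
`countPointsFast … 3 = 4` (`a₃ = 0`), `gcd(Δ, c₄) = 1`. Binders `hS`, `hGZK`, `hmod`; data `hr`, `hs`/`hv`. OFFER; nothing booked here;
no named fact; no `sorry`. HONEST FRAMING: BSD is not proved for any curve by this file; JSW's theorem is neither used nor disputed.
References: Sprung 2024 Cor. 1.3 [Sprung2024]; Silverman *AEC* [SilvermanAEC2009]; Kraus 1989 [Kraus1989]; Miller 2011 [Miller2011LMS];
Cremona [Cremona2006]; Jetchev–Skinner–Wan 2017 Thm. 1.2.1 [JetchevSkinnerWan2017] (the road NOT taken).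
-/

set_option autoImplicit false
set_option linter.dupNamespace false

noncomputable section

open scoped Classical

open WeierstrassCurve Literature.NumberTheory.EllipticCurves
  Literature.NumberTheory.EllipticCurves.Rank1Residual
  Literature.NumberTheory.EllipticCurves.Rank1Residual.Typed
  Literature.NumberTheory.EllipticCurves.Rank1Residual.X11RankOneCertificates
  Summit.BirchSwinnertonDyer.Rank1Residual.X11b
  Summit.BirchSwinnertonDyer.Rank1Residual.Supersingular

namespace Summit.BirchSwinnertonDyer.BirchSwinnertonDyer.Theorems.X6
/-- **`BSD(E,3)` for `230230n1`** [SPRUNG-ROAD pre-positioning record on a RESIDUE class at `3`] (X6 ∩ {r = 1}: `N = 230230` square-free, good supersingular at `3` (`#Ẽ(𝔽_{3}) = 4`, `a_{3} = 0`, kernel count); Cremona model `[1,-1,0,-2433845,1461747125]`; `r_an = 1`; `#E(ℚ)_tors = 2`; `#Ш_an = 1` (a `3`-unit), `∏ c_ℓ = 8`; register entries of record `JSW-ss@3`; OPEN cell(s) `(5, 'X11b')` — the class is RESIDUE, so nothing moves by this record today). Kernel: `Δ ≠ 0`, minimality, `3 ∤ Δ`, the point count, `gcd(Δ, c₄) =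 1`. Binders: `hS` (Sprung 2024 Cor. 1.3 (ii), REFEREED, A96), `hGZK`, `hmod`; data `hr`, `hs`/`hv`. Per pair; OFFER; nothing booked; tier = A96's word (α) (desk).
[cite: Sprung2024, Cor. 1.3 (p. 5), second sentence] [cite: Miller2011LMS, §1 and Def. 1.1] [cite: Cremona2006, Table 1 (Cremona label 230230n1)] -/
theorem bsdp_spr_230230n1_3 (hS : Sprung2024.cor13_padicValRat_bsd_rank_one_le)
    (hGZK : rank_eq_analyticRank_of_analyticRank_le_one) (hmod : hasEntireLFunction_rat)
    (W : WeierstrassCurve ℚ) (hW : W = ⟨1, -1, 0, -2433845, 1461747125⟩)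
    (hr : W.analyticRank = 1) {s : ℚ} (hs : shaAn W = (s : ℂ)) (hv : padicValRat 3 s ≤ 0) : BSDp W 3 := by
  subst hW
  haveI : Fact (Nat.Prime 3) := ⟨by norm_num⟩
  exact X6RankOne.bsdp_three_of_cor13_of_ainvs_of_countPointsFast_of_shaAn_unit hS hGZK hmod
    1 (-1) 0 (-2433845) 1461747125 (by decide +kernel) (by decide +kernel) (by decide +kernel)
    (by decide +kernel) (by decide +kernel) hr hs hv

/-- **`BSD(E,3)` for `255430h1`** [SPRUNG-ROAD pre-positioning record on a RESIDUE class at `3`] (X6 ∩ {r = 1}: `N = 255430` square-free, good supersingular at `3` (`#Ẽ(𝔽_{3}) = 4`, `a_{3} = 0`, kernel count); Cremona model `[1,-1,1,-188882017,-1016089530959]`; `r_an = 1`; `#E(ℚ)_tors = 1`; `#Ш_an = 1` (a `3`-unit), `∏ c_ℓ = 2025`; register entries of record `JSW-ss@3`; OPEN cell(s) `(5, 'X11b')` — the class is RESIDUE, so nothing moves by this record today). Kernel: `Δ ≠ 0`, minimality, `3 ∤ Δ`, the point count, `gcd(Δ, c₄) = 1`. Binders: `hS` (Sprung 2024 Cor.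 1.3 (ii), REFEREED, A96), `hGZK`, `hmod`; data `hr`, `hs`/`hv`. Per pair; OFFER; nothing booked; tier = A96's word (α) (desk).
[cite: Sprung2024, Cor. 1.3 (p. 5), second sentence] [cite: Miller2011LMS, §1 and Def. 1.1] [cite: Cremona2006, Table 1 (Cremona label 255430h1)] -/
theorem bsdp_spr_255430h1_3 (hS : Sprung2024.cor13_padicValRat_bsd_rank_one_le)
    (hGZK : rank_eq_analyticRank_of_analyticRank_le_one) (hmod : hasEntireLFunction_rat)
    (W : WeierstrassCurve ℚ) (hW : W = ⟨1, -1, 1, -188882017, -1016089530959⟩)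
    (hr : W.analyticRank = 1) {s : ℚ} (hs : shaAn W = (s : ℂ)) (hv : padicValRat 3 s ≤ 0) : BSDp W 3 := by
  subst hW
  haveI : Fact (Nat.Prime 3) := ⟨by norm_num⟩
  exact X6RankOne.bsdp_three_of_cor13_of_ainvs_of_countPointsFast_of_shaAn_unit hS hGZK hmod
    1 (-1) 1 (-188882017) (-1016089530959) (by decide +kernel) (by decide +kernel) (by decide +kernel)
    (by decide +kernel) (by decide +kernel) hr hs hv

/-- **`BSD(E,3)` for `279370m1`** [SPRUNG-ROAD pre-positioning record on a RESIDUE class at `3`] (X6 ∩ {r = 1}: `N = 279370` square-free, good supersingular at `3` (`#Ẽ(𝔽_{3}) = 4`, `a_{3} = 0`, kernel count); Cremona model `[1,-1,1,-38197,-2785331]`; `r_an = 1`; `#E(ℚ)_tors = 2`; `#Ш_an = 1` (a `3`-unit), `∏ c_ℓ = 200`; register entries of record `JSW-ss@3`; OPEN cell(s) `(5, 'X11b')` — the class is RESIDUE, so nothing moves by this record today). Kernel: `Δ ≠ 0`, minimality, `3 ∤ Δ`, the point count, `gcd(Δ, c₄) = 1`. Binders: `hS` (Sprung 2024 Cor.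 1.3 (ii), REFEREED, A96), `hGZK`, `hmod`; data `hr`, `hs`/`hv`. Per pair; OFFER; nothing booked; tier = A96's word (α) (desk).
[cite: Sprung2024, Cor. 1.3 (p. 5), second sentence] [cite: Miller2011LMS, §1 and Def. 1.1] [cite: Cremona2006, Table 1 (Cremona label 279370m1)] -/
theorem bsdp_spr_279370m1_3 (hS : Sprung2024.cor13_padicValRat_bsd_rank_one_le)
    (hGZK : rank_eq_analyticRank_of_analyticRank_le_one) (hmod : hasEntireLFunction_rat)
    (W : WeierstrassCurve ℚ) (hW : W = ⟨1, -1, 1, -38197, -2785331⟩)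
    (hr : W.analyticRank = 1) {s : ℚ} (hs : shaAn W = (s : ℂ)) (hv : padicValRat 3 s ≤ 0) : BSDp W 3 := by
  subst hW
  haveI : Fact (Nat.Prime 3) := ⟨by norm_num⟩
  exact X6RankOne.bsdp_three_of_cor13_of_ainvs_of_countPointsFast_of_shaAn_unit hS hGZK hmod
    1 (-1) 1 (-38197) (-2785331) (by decide +kernel) (by decide +kernel) (by decide +kernel)
    (by decide +kernel) (by decide +kernel) hr hs hv

/-- **`BSD(E,3)` for `324310o1`** [SPRUNG-ROAD pre-positioning record on a RESIDUE class at `3`] (X6 ∩ {r = 1}: `N = 324310` square-free, good supersingular at `3` (`#Ẽ(𝔽_{3}) = 4`, `a_{3} = 0`, kernel count); Cremona model `[1,-1,1,-3887902,-3678422099]`; `r_an = 1`; `#E(ℚ)_tors = 1`; `#Ш_an = 1` (a `3`-unit), `∏ c_ℓ = 2100`; register entries of record `JSW-ss@3`; OPEN cell(s) `(5, 'X11b')` — the class is RESIDUE, so nothing moves by this record today). Kernel: `Δ ≠ 0`, minimality, `3 ∤ Δ`, the point count, `gcd(Δ, c₄) = 1`. Binders: `hS` (Sprung 2024 Cor.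 1.3 (ii), REFEREED, A96), `hGZK`, `hmod`; data `hr`, `hs`/`hv`. Per pair; OFFER; nothing booked; tier = A96's word (α) (desk).
[cite: Sprung2024, Cor. 1.3 (p. 5), second sentence] [cite: Miller2011LMS, §1 and Def. 1.1] [cite: Cremona2006, Table 1 (Cremona label 324310o1)] -/
theorem bsdp_spr_324310o1_3 (hS : Sprung2024.cor13_padicValRat_bsd_rank_one_le)
    (hGZK : rank_eq_analyticRank_of_analyticRank_le_one) (hmod : hasEntireLFunction_rat)
    (W : WeierstrassCurve ℚ) (hW : W = ⟨1, -1, 1, -3887902, -3678422099⟩)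
    (hr : W.analyticRank = 1) {s : ℚ} (hs : shaAn W = (s : ℂ)) (hv : padicValRat 3 s ≤ 0) : BSDp W 3 := by
  subst hW
  haveI : Fact (Nat.Prime 3) := ⟨by norm_num⟩
  exact X6RankOne.bsdp_three_of_cor13_of_ainvs_of_countPointsFast_of_shaAn_unit hS hGZK hmod
    1 (-1) 1 (-3887902) (-3678422099) (by decide +kernel) (by decide +kernel) (by decide +kernel)
    (by decide +kernel) (by decide +kernel) hr hs hv

/-- **`BSD(E,3)` for `384710o1`** [SPRUNG-ROAD pre-positioning record on a RESIDUE class at `3`] (X6 ∩ {r = 1}: `N = 384710` square-free, good supersingular at `3` (`#Ẽ(𝔽_{3}) = 4`, `a_{3} = 0`, kernel count); Cremona model `[1,-1,1,47033,-77971009]`; `r_an = 1`; `#E(ℚ)_tors = 1`; `#Ш_an = 1` (a `3`-unit), `∏ c_ℓ = 450`; register entries of record `JSW-ss@3`; OPEN cell(s) `(5, 'X11b')` — the class is RESIDUE, so nothing moves by this record today). Kernel: `Δ ≠ 0`, minimality, `3 ∤ Δ`, the point count, `gcd(Δ, c₄) = 1`. Binders: `hS` (Sprung 2024 Cor. 1.3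 (ii), REFEREED, A96), `hGZK`, `hmod`; data `hr`, `hs`/`hv`. Per pair; OFFER; nothing booked; tier = A96's word (α) (desk).
[cite: Sprung2024, Cor. 1.3 (p. 5), second sentence] [cite: Miller2011LMS, §1 and Def. 1.1] [cite: Cremona2006, Table 1 (Cremona label 384710o1)] -/
theorem bsdp_spr_384710o1_3 (hS : Sprung2024.cor13_padicValRat_bsd_rank_one_le)
    (hGZK : rank_eq_analyticRank_of_analyticRank_le_one) (hmod : hasEntireLFunction_rat)
    (W : WeierstrassCurve ℚ) (hW : W = ⟨1, -1, 1, 47033, -77971009⟩)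
    (hr : W.analyticRank = 1) {s : ℚ} (hs : shaAn W = (s : ℂ)) (hv : padicValRat 3 s ≤ 0) : BSDp W 3 := by
  subst hW
  haveI : Fact (Nat.Prime 3) := ⟨by norm_num⟩
  exact X6RankOne.bsdp_three_of_cor13_of_ainvs_of_countPointsFast_of_shaAn_unit hS hGZK hmod
    1 (-1) 1 47033 (-77971009) (by decide +kernel) (by decide +kernel) (by decide +kernel)
    (by decide +kernel) (by decide +kernel) hr hs hv

/-- **`BSD(E,3)` for `415415i1`** [SPRUNG-ROAD pre-positioning record on a RESIDUE class at `3`] (X6 ∩ {r = 1}: `N = 415415` square-free, good supersingular at `3` (`#Ẽ(𝔽_{3}) = 4`, `a_{3} = 0`, kernel count); Cremona model `[0,0,1,27598,1054210]`; `r_an = 1`; `#E(ℚ)_tors = 1`; `#Ш_an = 1` (a `3`-unit), `∏ c_ℓ = 100`; register entries of record `JSW-ss@3`; OPEN cell(s) `(5, 'X11b')` — the class is RESIDUE, so nothing moves by this record today). Kernel: `Δ ≠ 0`, minimality, `3 ∤ Δ`, the point count, `gcd(Δ, c₄) = 1`. Binders: `hS` (Sprung 2024 Cor. 1.3 (ii),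 REFEREED, A96), `hGZK`, `hmod`; data `hr`, `hs`/`hv`. Per pair; OFFER; nothing booked; tier = A96's word (α) (desk).
[cite: Sprung2024, Cor. 1.3 (p. 5), second sentence] [cite: Miller2011LMS, §1 and Def. 1.1] [cite: Cremona2006, Table 1 (Cremona label 415415i1)] -/
theorem bsdp_spr_415415i1_3 (hS : Sprung2024.cor13_padicValRat_bsd_rank_one_le)
    (hGZK : rank_eq_analyticRank_of_analyticRank_le_one) (hmod : hasEntireLFunction_rat)
    (W : WeierstrassCurve ℚ) (hW : W = ⟨0, 0, 1, 27598, 1054210⟩)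
    (hr : W.analyticRank = 1) {s : ℚ} (hs : shaAn W = (s : ℂ)) (hv : padicValRat 3 s ≤ 0) : BSDp W 3 := by
  subst hW
  haveI : Fact (Nat.Prime 3) := ⟨by norm_num⟩
  exact X6RankOne.bsdp_three_of_cor13_of_ainvs_of_countPointsFast_of_shaAn_unit hS hGZK hmod
    0 0 1 27598 1054210 (by decide +kernel) (by decide +kernel) (by decide +kernel)
    (by decide +kernel) (by decide +kernel) hr hs hv

/-- **`BSD(E,3)` for `420970m1`** [SPRUNG-ROAD pre-positioning record on a RESIDUE class at `3`] (X6 ∩ {r = 1}: `N = 420970` square-free, good supersingular at `3` (`#Ẽ(𝔽_{3}) = 4`, `a_{3} = 0`, kernel count); Cremona model `[1,-1,1,-4036762,3113811161]`; `r_an = 1`; `#E(ℚ)_tors = 2`; `#Ш_an = 1` (a `3`-unit), `∏ c_ℓ = 400`; register entries of record `JSW-ss@3`; OPEN cell(s) `(5, 'X11b')` — the class is RESIDUE, so nothing moves by this record today). Kernel: `Δ ≠ 0`, minimality, `3 ∤ Δ`, the point count, `gcd(Δ, c₄) = 1`. Binders: `hS` (Sprung 2024 Cor. 1.3 (ii),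 REFEREED, A96), `hGZK`, `hmod`; data `hr`, `hs`/`hv`. Per pair; OFFER; nothing booked; tier = A96's word (α) (desk).
[cite: Sprung2024, Cor. 1.3 (p. 5), second sentence] [cite: Miller2011LMS, §1 and Def. 1.1] [cite: Cremona2006, Table 1 (Cremona label 420970m1)] -/
theorem bsdp_spr_420970m1_3 (hS : Sprung2024.cor13_padicValRat_bsd_rank_one_le)
    (hGZK : rank_eq_analyticRank_of_analyticRank_le_one) (hmod : hasEntireLFunction_rat)
    (W : WeierstrassCurve ℚ) (hW : W = ⟨1, -1, 1, -4036762, 3113811161⟩)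
    (hr : W.analyticRank = 1) {s : ℚ} (hs : shaAn W = (s : ℂ)) (hv : padicValRat 3 s ≤ 0) : BSDp W 3 := by
  subst hW
  haveI : Fact (Nat.Prime 3) := ⟨by norm_num⟩
  exact X6RankOne.bsdp_three_of_cor13_of_ainvs_of_countPointsFast_of_shaAn_unit hS hGZK hmod
    1 (-1) 1 (-4036762) 3113811161 (by decide +kernel) (by decide +kernel) (by decide +kernel)
    (by decide +kernel) (by decide +kernel) hr hs hv

end Summit.BirchSwinnertonDyer.BirchSwinnertonDyer.Theorems.X6

end
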